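import Mathlib
import Summits.Parity.BatemanHorn.Theorems.IsogenyRedeiTypeIMainTermCounting
import Summits.Parity.BatemanHorn.Theorems.IsogenyRedeiTypeIMainTermRieszBound
import HarnessLib

/-!
# Type-I main term for Bateman–Horn (stmt-Parity-0873), input D2: the error term

`∑_{d ∈ [1,X]^k, ∏ d_i ≤ X} |w(d)| ρ(d) ≪ X (log X)^c` where `ρ(d) = sysCount f d`: only square-free
tuples contribute, `ρ(d) ≤ ω_F(lcm d) ≤ B^{ω(lcm d)} ≤ ∏ τ(d_i)^{c₀}` (`F = ∏ f_i`), and the resulting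
sum is a partial sum of a Dirichlet power of `τ^{c₀}`, bounded by the tree's divisor-power sums.
Also the little-o statement `X (log X)^c = o(x)` for `X = x^{1-η}`. Everything here is proved.
-/

noncomputable section

open Finset Polynomial ArithmeticFunction Filter Topology Asymptotics
open scoped ArithmeticFunction.Moebius ArithmeticFunction.sigma

namespace Summit.Parity.BatemanHorn.Theorems.TypeIMainTerm

open Literature.NumberTheory.Sieve Literature.NumberTheory.LFunctions

variable {k : ℕ} (f : Fin k → ℤ[X])

/-- The lcm of square-free numbers is square-free. -/
theorem squarefree_tupleLcm {d : Fin k → ℕ} (hd : ∀ i, Squarefree (d i)) :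
    Squarefree (tupleLcm d) := by
  have hd0 : ∀ i, d i ≠ 0 := fun i => (hd i).ne_zero
  have hL0 : tupleLcm d ≠ 0 := (tupleLcm_pos (fun i => Nat.pos_of_ne_zero (hd0 i))).ne'
  rw [Nat.squarefree_iff_factorization_le_one hL0]
  intro p
  unfold tupleLcm
  rw [Finset.factorization_lcm (fun i _ => hd0 i)]
  exact Finset.sup_le fun i _ => (Nat.squarefree_iff_factorization_le_one (hd0 i)).mp (hd i) p

/-- `ρ(d) ≤ ω_F(lcm d)` with `F = ∏ f_i`. -/
theorem sysCount_le_rootCount_prod (d : Fin k → ℕ) :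
    sysCount f d ≤ polyRootCountMod ![∏ i, f i] (tupleLcm d) := by
  classical
  rw [polyRootCountMod_single]
  unfold sysCount sysSols
  refine Finset.card_le_card fun n hn => ?_
  rw [Finset.mem_filter] at hn ⊢
  refine ⟨hn.1, ?_⟩
  rw [Polynomial.eval_prod]
  have h : ∀ i, ((d i : ℕ) : ℤ) ∣ ∏ j, (f j).eval (n : ℤ) := fun i =>
    (hn.2 i).trans (Finset.dvd_prod_of_mem _ (Finset.mem_univ i))
  exact Int.natCast_dvd.mpr (Finset.lcm_dvd fun i _ => Int.natCast_dvd.mp (h i))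

/-- `ω(lcm d) ≤ ∑ ω(d_i)`. -/
theorem card_primeFactors_tupleLcm_le {d : Fin k → ℕ} (hd : ∀ i, 0 < d i) :
    (tupleLcm d).primeFactors.card ≤ ∑ i, (d i).primeFactors.card := by
  classical
  have hP0 : ∏ i, d i ≠ 0 := Finset.prod_ne_zero_iff.mpr fun i _ => (hd i).ne'
  calc (tupleLcm d).primeFactors.card ≤ (∏ i, d i).primeFactors.card :=
        Finset.card_le_card (Nat.primeFactors_mono (tupleLcm_dvd_prod d) hP0)
    _ ≤ (Finset.univ.biUnion fun i => (d i).primeFactors).card := by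
        refine Finset.card_le_card fun p hp => ?_
        rw [Finset.mem_biUnion]
        have hp' := Nat.prime_of_mem_primeFactors hp
        obtain ⟨i, -, hi⟩ := (Prime.dvd_finsetProd_iff hp'.prime _).mp (Nat.dvd_of_mem_primeFactors hp)
        exact ⟨i, Finset.mem_univ _, Nat.mem_primeFactors.mpr ⟨hp', hi, (hd i).ne'⟩⟩
    _ ≤ ∑ i, (d i).primeFactors.card := Finset.card_biUnion_le

/-- Pointwise bound: `|w(d)| ρ(d) ≤ (log X)^k ∏ τ(d_i)^{c₀}` on the box `[1, X]^k`, where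
`B ≤ 2^{c₀}` bounds `ω_F(p)`. -/
theorem abs_wt_mul_sysCount_le {B : ℝ} (hB1 : 1 ≤ B)
    (hB : ∀ p : ℕ, p.Prime → (polyRootCountMod ![∏ i, f i] p : ℝ) ≤ B) {c₀ : ℕ} (hc₀ : B ≤ 2 ^ c₀)
    {X : ℝ} {d : Fin k → ℕ} (hd : ∀ i, 1 ≤ d i ∧ (d i : ℝ) ≤ X) :
    |wt d| * (sysCount f d : ℝ) ≤ Real.log X ^ k * ∏ i, (σ 0 (d i) : ℝ) ^ c₀ := by
  have hpos : ∀ i, 0 < d i := fun i => (hd i).1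
  by_cases hsq : ∀ i, Squarefree (d i)
  · -- `|w(d)| ≤ (log X)^k`
    have h1 : |wt d| ≤ Real.log X ^ k := by
      rw [wt_apply, Finset.abs_prod]
      calc ∏ i, |(μ (d i) : ℝ) * Real.log (d i)| ≤ ∏ _i : Fin k, Real.log X := by
            refine Finset.prod_le_prod (fun i _ => abs_nonneg _) fun i _ => ?_
            have hlog : 0 ≤ Real.log (d i) := Real.log_nonneg (by exact_mod_cast (hd i).1)
            rw [abs_mul, abs_of_nonneg hlog]
            calc |(μ (d i) : ℝ)| * Real.log (d i) ≤ 1 * Real.log (d i) := by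
                  refine mul_le_mul_of_nonneg_right ?_ hlog
                  have := abs_moebius_le_one (n := d i)
                  exact_mod_cast this
              _ ≤ Real.log X := by
                  rw [one_mul]
                  exact Real.log_le_log (by exact_mod_cast (hd i).1) (hd i).2
        _ = Real.log X ^ k := by rw [Finset.prod_const, Finset.card_univ, Fintype.card_fin]
    -- `ρ(d) ≤ ∏ τ(d_i)^{c₀}`
    have h2 : (sysCount f d : ℝ) ≤ ∏ i, (σ 0 (d i) : ℝ) ^ c₀ := by
      calc (sysCount f d : ℝ) ≤ polyRootCountMod ![∏ i, f i] (tupleLcm d) := by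
            exact_mod_cast sysCount_le_rootCount_prod f d
        _ ≤ B ^ (tupleLcm d).primeFactors.card :=
            rootCount_le_pow_of_squarefree _ hB (squarefree_tupleLcm hsq)
        _ ≤ B ^ ∑ i, (d i).primeFactors.card :=
            pow_le_pow_right₀ hB1 (card_primeFactors_tupleLcm_le hpos)
        _ = ∏ i, B ^ (d i).primeFactors.card := Finset.prod_pow_eq_pow_sum _ _ _ |>.symm
        _ ≤ ∏ i, (σ 0 (d i) : ℝ) ^ c₀ := by
            refine Finset.prod_le_prod (fun i _ => by positivity) fun i _ => ?_
            calc B ^ (d i).primeFactors.card ≤ ((2 : ℝ) ^ c₀) ^ (d i).primeFactors.card :=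
                  pow_le_pow_left₀ (by linarith) hc₀ _
              _ = ((2 : ℝ) ^ (d i).primeFactors.card) ^ c₀ := by rw [← pow_mul, ← pow_mul, mul_comm]
              _ ≤ (σ 0 (d i) : ℝ) ^ c₀ :=
                  pow_le_pow_left₀ (by positivity)
                    (FriedlanderIwaniecPrimesSquarefree.two_pow_card_primeFactors_le_sigma _
                      (hpos i).ne') _
    have hlog0 : 0 ≤ Real.log X ^ k := by
      rcases k.eq_zero_or_pos with hk | hk
      · subst hk; simp
      · obtain ⟨i⟩ : Nonempty (Fin k) := ⟨⟨0, hk⟩⟩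
        exact pow_nonneg ((Real.log_nonneg (by exact_mod_cast (hd i).1)).trans
          (Real.log_le_log (by exact_mod_cast (hd i).1) (hd i).2)) _
    exact mul_le_mul h1 h2 (Nat.cast_nonneg _) hlog0
  · -- a non-square-free entry kills the weight
    push Not at hsq
    obtain ⟨i, hi⟩ := hsq
    have h0 : wt d = 0 := by
      rw [wt_apply]
      refine Finset.prod_eq_zero (Finset.mem_univ i) ?_
      rw [ArithmeticFunction.moebius_eq_zero_of_not_squarefree hi]
      simp
    rw [h0, abs_zero, zero_mul]
    exact mul_nonneg (by
      rcases k.eq_zero_or_pos with hk | hk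
      · subst hk; simp
      · obtain ⟨j⟩ : Nonempty (Fin k) := ⟨⟨0, hk⟩⟩
        exact pow_nonneg ((Real.log_nonneg (by exact_mod_cast (hd j).1)).trans
          (Real.log_le_log (by exact_mod_cast (hd j).1) (hd j).2)) _)
      (Finset.prod_nonneg fun _ _ => by positivity)

/-- `|(H^j)(n)| ≤ τ(n)^{(c₀+1) j}` when `|H| ≤ τ^{c₀}`. -/
theorem abs_pow_apply_le_sigma_pow {H : ArithmeticFunction ℝ} {c₀ : ℕ}
    (hH : ∀ n, |H n| ≤ (σ 0 n : ℝ) ^ c₀) (j n : ℕ) :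
    |(H ^ j) n| ≤ (σ 0 n : ℝ) ^ ((c₀ + 1) * j) := by
  induction j generalizing n with
  | zero =>
    rw [pow_zero, mul_zero, pow_zero, ArithmeticFunction.one_apply]
    split_ifs <;> simp
  | succ j ih =>
    rw [pow_succ']
    have h := abs_mul_apply_le_sigma_zero_pow (a := c₀) (b := (c₀ + 1) * j) zero_le_one zero_le_one
      (fun d => by rw [one_mul]; exact hH d) (fun e => by rw [one_mul]; exact ih e) n
    rw [one_mul, one_mul] at h
    convert h using 2
    ring

/-- **The error term**: `∑_{d ∈ [1,X]^k, ∏ d_i ≤ X} |w(d)| ρ(d) ≤ C X (log X)^c` for `X ≥ 2`. -/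
theorem exists_error_bound (hsys : IsBatemanHornSystem f) :
    ∃ C : ℝ, ∃ c : ℕ, 0 < C ∧ ∀ X : ℝ, 2 ≤ X →
      ∑ d ∈ (Fintype.piFinset fun _ : Fin k => Icc 1 ⌊X⌋₊).filter (fun d => ∏ i, (d i : ℝ) ≤ X),
        |wt d| * (sysCount f d : ℝ) ≤ C * X * Real.log X ^ c := by
  classical
  have hF0 : ∏ i, f i ≠ 0 := Finset.prod_ne_zero_iff.mpr fun i _ => (hsys.irreducible i).ne_zero
  obtain ⟨B, hB1, hB⟩ := exists_rootCount_prime_le hF0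
  -- `B ≤ 2^{c₀}` with `c₀ ≥ 1`
  set c₀ : ℕ := ⌈B⌉₊ with hc₀def
  have hc₀ : B ≤ 2 ^ c₀ :=
    (Nat.le_ceil B).trans (by exact_mod_cast (Nat.lt_two_pow_self (n := c₀)).le)
  have hc₀1 : 1 ≤ c₀ := Nat.one_le_iff_ne_zero.mpr (by
    rw [hc₀def]; exact (Nat.lt_ceil.mpr (by push_cast; linarith)).ne')
  -- the comparison function `H = τ^{c₀}`
  set H : ArithmeticFunction ℝ := ⟨fun n => (σ 0 n : ℝ) ^ c₀, by
    simp only [ArithmeticFunction.map_zero, Nat.cast_zero]; exact zero_pow (by omega)⟩ with hHdef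
  have hH : ∀ n, |H n| ≤ (σ 0 n : ℝ) ^ c₀ := fun n => by
    show |(σ 0 n : ℝ) ^ c₀| ≤ _
    rw [abs_of_nonneg (by positivity)]
  obtain ⟨C, hC, hsum⟩ := exists_sum_sigma_zero_pow_le_real ((c₀ + 1) * k)
  refine ⟨C, k + 2 ^ ((c₀ + 1) * k + 1), hC, fun X hX => ?_⟩
  have hX0 : 0 ≤ X := by linarith
  have hlog0 : 0 ≤ Real.log X := Real.log_nonneg (by linarith)
  -- pointwise bound and regrouping
  calc ∑ d ∈ (Fintype.piFinset fun _ : Fin k => Icc 1 ⌊X⌋₊).filter (fun d => ∏ i, (d i : ℝ) ≤ X),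
          |wt d| * (sysCount f d : ℝ)
      ≤ ∑ d ∈ (Fintype.piFinset fun _ : Fin k => Icc 1 ⌊X⌋₊).filter (fun d => ∏ i, (d i : ℝ) ≤ X),
          Real.log X ^ k * ∏ i, H (d i) := by
        refine Finset.sum_le_sum fun d hd => ?_
        rw [Finset.mem_filter, Fintype.mem_piFinset] at hd
        refine abs_wt_mul_sysCount_le f hB1 hB hc₀ fun i => ?_
        have := Finset.mem_Icc.mp (hd.1 i)
        exact ⟨this.1, (show (d i : ℝ) ≤ ⌊X⌋₊ by exact_mod_cast this.2).trans (Nat.floor_le hX0)⟩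
    _ = Real.log X ^ k * ∑ m ∈ Ioc 0 ⌊X⌋₊, (H ^ k) m := by
        rw [← Finset.mul_sum, sum_box_filter_eq_sum_Ioc _ hX0]
        congr 1
        refine Finset.sum_congr rfl fun m _ => ?_
        rw [show H ^ k = ∏ _i : Fin k, H by rw [Finset.prod_const, Finset.card_univ, Fintype.card_fin],
          ArithmeticFunction.prod_apply_eq_sum_finMulAntidiag]
    _ ≤ Real.log X ^ k * ∑ m ∈ Icc 1 ⌊X⌋₊, (σ 0 m : ℝ) ^ ((c₀ + 1) * k) := by
        refine mul_le_mul_of_nonneg_left ?_ (pow_nonneg hlog0 _)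
        rw [show Ioc 0 ⌊X⌋₊ = Icc 1 ⌊X⌋₊ from rfl]
        exact Finset.sum_le_sum fun m _ => (le_abs_self _).trans (abs_pow_apply_le_sigma_pow hH k m)
    _ ≤ Real.log X ^ k * (C * X * Real.log X ^ 2 ^ ((c₀ + 1) * k + 1)) :=
        mul_le_mul_of_nonneg_left (hsum X hX) (pow_nonneg hlog0 _)
    _ = C * X * Real.log X ^ (k + 2 ^ ((c₀ + 1) * k + 1)) := by ring

/-- `C x^{1-η} (log x^{1-η})^c = o(x)` along the natural numbers, for `0 < η`. -/
theorem isLittleO_rpow_mul_log_pow {η : ℝ} (hη : 0 < η) (C : ℝ) (c : ℕ) :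
    (fun x : ℕ => C * (x : ℝ) ^ (1 - η) * Real.log ((x : ℝ) ^ (1 - η)) ^ c) =o[atTop]
      (fun x : ℕ => (x : ℝ)) := by
  have h1 : (fun x : ℝ => Real.log x ^ c) =o[atTop] fun x : ℝ => x ^ η := by
    have := isLittleO_log_rpow_rpow_atTop (c : ℝ) hη
    refine this.congr' ?_ EventuallyEq.rfl
    filter_upwards [eventually_ge_atTop 1] with x hx
    rw [← Real.rpow_natCast]
  have h2 : (fun x : ℝ => x ^ (1 - η) * Real.log x ^ c) =o[atTop] fun x : ℝ => x ^ (1 - η) * x ^ η :=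
    (isBigO_refl (fun x : ℝ => x ^ (1 - η)) atTop).mul_isLittleO h1
  have h3 : (fun x : ℝ => x ^ (1 - η) * Real.log x ^ c) =o[atTop] fun x : ℝ => x := by
    refine h2.congr' EventuallyEq.rfl ?_
    filter_upwards [eventually_gt_atTop 0] with x hx
    rw [← Real.rpow_add hx, sub_add_cancel, Real.rpow_one]
  have h4 : (fun x : ℝ => C * (1 - η) ^ c * (x ^ (1 - η) * Real.log x ^ c)) =o[atTop] fun x : ℝ => x :=
    h3.const_mul_left _
  have h5 := h4.comp_tendsto tendsto_natCast_atTop_atTop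
  refine h5.congr' ?_ EventuallyEq.rfl
  filter_upwards [eventually_gt_atTop 0] with x hx
  have hx0 : (0 : ℝ) < x := by exact_mod_cast hx
  simp only [Function.comp]
  rw [Real.log_rpow hx0, mul_pow]
  ring

end Summit.Parity.BatemanHorn.Theorems.TypeIMainTerm

end
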